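import Summits.MatrixMultiplication.OmegaCensus.SmallFormats.MatMul22nRankGF7Slack5Search
import HarnessLib

/-!
# ω-census family (a): replay of the slack-5 search certificate, CHECK B part 8 of 8 (classes `532 ≤ c < 656`)

Cell `pub-omega` (unit `pub-omega-tensor-g16`), topic `Summits/MatrixMultiplication/OmegaCensus` (sub-folder `SmallFormats`).
Framing (verbatim): lottery ticket; floor = certified bounds/negative ranges. HONEST FRAMING: machine-generated kernel replay
(`pub-omega-tensor-g16/code/gen5_runs.py`): `search5 c = true` for the classes `532 ≤ c < 656` (7609 search nodes in 6 `decide`s).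
Meaning (`search5_sound`, `MatMul22nRankGF7Slack5SearchSound`): no LP-tight point of slack 5 has one of these representatives as torus-0 column.
Nothing here is progress on `ω`.
-/

namespace Summit.MatrixMultiplication.OmegaCensus.SmallFormats

set_option Elab.async false

set_option maxRecDepth 100000 in
set_option maxHeartbeats 400000000 in
/-- Classes `532 ≤ c < 557` (1485 nodes). -/
theorem search5_ok_532_557 : ∀ c : Fin 656, 532 ≤ c.val → c.val < 557 → search5 c.val = true := by decide +kernel

set_option maxRecDepth 100000 in
set_option maxHeartbeats 400000000 in
/-- Classes `557 ≤ c < 603` (1479 nodes). -/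
theorem search5_ok_557_603 : ∀ c : Fin 656, 557 ≤ c.val → c.val < 603 → search5 c.val = true := by decide +kernel

set_option maxRecDepth 100000 in
set_option maxHeartbeats 400000000 in
/-- Classes `603 ≤ c < 636` (1385 nodes). -/
theorem search5_ok_603_636 : ∀ c : Fin 656, 603 ≤ c.val → c.val < 636 → search5 c.val = true := by decide +kernel

set_option maxRecDepth 100000 in
set_option maxHeartbeats 400000000 in
/-- Classes `636 ≤ c < 649` (871 nodes). -/
theorem search5_ok_636_649 : ∀ c : Fin 656, 636 ≤ c.val → c.val < 649 → search5 c.val = true := by decide +kernel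

set_option maxRecDepth 100000 in
set_option maxHeartbeats 400000000 in
/-- Classes `649 ≤ c < 651` (1457 nodes). -/
theorem search5_ok_649_651 : ∀ c : Fin 656, 649 ≤ c.val → c.val < 651 → search5 c.val = true := by decide +kernel

set_option maxRecDepth 100000 in
set_option maxHeartbeats 400000000 in
/-- Classes `651 ≤ c < 656` (932 nodes). -/
theorem search5_ok_651_656 : ∀ c : Fin 656, 651 ≤ c.val → c.val < 656 → search5 c.val = true := by decide +kernel

/-- CHECK B for the classes `532 ≤ c < 656`. -/
theorem search5_run_8 : ∀ c : Fin 656, 532 ≤ c.val → c.val < 656 → search5 c.val = true := by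
  intro c hlo hhi
  by_cases h557 : c.val < 557
  · exact search5_ok_532_557 c (by omega) h557
  by_cases h603 : c.val < 603
  · exact search5_ok_557_603 c (by omega) h603
  by_cases h636 : c.val < 636
  · exact search5_ok_603_636 c (by omega) h636
  by_cases h649 : c.val < 649
  · exact search5_ok_636_649 c (by omega) h649
  by_cases h651 : c.val < 651
  · exact search5_ok_649_651 c (by omega) h651
  exact search5_ok_651_656 c (by omega) hhi

end Summit.MatrixMultiplication.OmegaCensus.SmallFormats
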